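import Summits.AtomisticToContinuum.BoseEinsteinCondensation.Theorems.BECGroundStateSOSPeriodicIRBoundFsumDCPotPair
import HarnessLib

/-!
# Crux `PeriodicIRBound` (stmt-AtomisticToContinuum-3972), line `fsum-phase-pencil`, stub S3
# `stub_phaseDoubleCommutator` — potential part, D: pair reduction for Bose-symmetric functions

For Bose-symmetric continuous `(m+2)`-body functions every pair `(i, j)` of the interaction
`W = ∑_{i<j} w^per(xᵢ − xⱼ)` contributes the same as the pair `(0, 1)` (relabelling invariance of the cell),
and there are `C(m+2, 2) = (m+2)(m+1)/2` pairs: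

* `P_w[h] = (m+2)(m+1)/2 · Re pairForm h h` (`toReal_potForm_eq_pairs_mul`: the tree's `ℝ≥0∞` reduction
  `lintegral_cellN_periodicInteraction_mul_symm` for the symmetric density `|h|²`, read in `ℝ` through
  `pairForm_self_re`);
* `potRe_w(f, g) = (m+2)(m+1)/2 · Re pairForm f g` (`potRe_eq_pairs_mul`: polarisation of both sides along
  `f + g`, `toReal_potPart_add_smul` and the sesquilinearity of the pair form).

Registered by-product sub-goal `stub_fsumDCPotPairs`.
-/

noncomputable section

open MeasureTheory Filter
open scoped ENNReal NNReal ComplexConjugate BigOperators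

namespace Summit.AtomisticToContinuum.BoseEinsteinCondensation.Cruxes.PeriodicIRBound.FsumPhasePencil

open Literature.MathematicalPhysics.QuantumManyBody.BoseGas
open Summit.AtomisticToContinuum.BoseEinsteinCondensation.Cruxes.PeriodicIRBound.LinearPhFloorWagner.WF

variable {m : ℕ} {L : ℝ} {w : ℝ → ℝ≥0∞}

/-! ## Counting and symmetry bookkeeping -/

/-- The number of pairs among `m + 2` particles, as a real number: `C(m+2, 2) = (m+2)(m+1)/2`. [folklore] -/
theorem cast_choose_two_add_two (m : ℕ) : (((m + 2).choose 2 : ℕ) : ℝ) = (m + 2) * (m + 1) / 2 := by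
  rw [Nat.cast_choose_two ℝ (m + 2)]
  push_cast
  ring

/-- The sum of two Bose-symmetric functions (along a real line) is Bose-symmetric. [folklore] -/
theorem isSymm_add_ofReal_mul {M : ℕ} {f g : Config M → ℂ} (hf : IsSymm f) (hg : IsSymm g) (t : ℝ) :
    IsSymm fun X => f X + (t : ℂ) * g X := fun σ X => by
  dsimp only
  rw [hf σ X, hg σ X]

/-- `P_w[h] < ∞` for continuous `h` and integrable `w` (`h` is bounded on the cell, `∫_cell W < ∞`). [folklore] -/
theorem potForm_ne_top_of_continuous {M : ℕ} (hL : 0 < L) (hw : Measurable w) (hint : (∫⁻ z : Space, w ‖z‖) ≠ ⊤)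
    {h : Config M → ℂ} (hh : Continuous h) : potForm w L h ≠ ⊤ :=
  (lintegral_cellN_pot_sq_lt_top (lintegral_cellN_periodicInteraction_ne_top hL hw hint M) hh).ne

/-! ## The diagonal: `P_w[h]` as `C(m+2,2)` pair forms -/

/-- **Pair reduction in `ℝ≥0∞`**: `P_w[h] = C(m+2,2) ∫ w^per(x_0 − x_1) |h|²` for continuous Bose-symmetric `h`
(the density `|h|²` is relabelling invariant). [folklore] -/
theorem potForm_eq_choose_mul_lintegral_pairWeight (hw : Measurable w) (L : ℝ) {h : Config (m + 2) → ℂ}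
    (hh : Continuous h) (hs : IsSymm h) :
    potForm w L h = (((m + 2).choose 2 : ℕ) : ℝ≥0∞) *
      ∫⁻ X in cellN (m + 2) L, periodizedPotential w L (X 0 - X 1) * ((‖h X‖₊ : ℝ≥0∞)) ^ 2 :=
  lintegral_cellN_periodicInteraction_mul_symm hw L (hh.measurable.nnnorm.coe_nnreal_ennreal.pow_const _)
    fun σ X => by simp only [hs σ X]

/-- **The diagonal pair reduction**: `P_w[h].toReal = (m+2)(m+1)/2 · Re pairForm h h` for continuous
Bose-symmetric `h` and integrable `w`. [folklore] -/
theorem toReal_potForm_eq_pairs_mul (hL : 0 < L) (hw : Measurable w) (hint : (∫⁻ z : Space, w ‖z‖) ≠ ⊤)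
    {h : Config (m + 2) → ℂ} (hh : Continuous h) (hs : IsSymm h) :
    (potForm w L h).toReal = ((m + 2) * (m + 1) / 2 : ℝ) * (pairForm w L h h).re := by
  rw [potForm_eq_choose_mul_lintegral_pairWeight hw L hh hs, ENNReal.toReal_mul, ENNReal.toReal_natCast,
    cast_choose_two_add_two, pairForm_self_re hL hw hint hh]

/-! ## The polarised form -/

/-- **The polarised pair reduction**: `potRe_w(f, g) = (m+2)(m+1)/2 · Re pairForm f g` for continuous
Bose-symmetric `f, g` and integrable `w` (polarise `P_w[f + g]` and `Re pairForm (f+g) (f+g)`). [folklore] -/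
theorem potRe_eq_pairs_mul (hL : 0 < L) (hw : Measurable w) (hint : (∫⁻ z : Space, w ‖z‖) ≠ ⊤)
    {f g : Config (m + 2) → ℂ} (hf : Continuous f) (hg : Continuous g) (hfs : IsSymm f) (hgs : IsSymm g) :
    potRe w L f g = ((m + 2) * (m + 1) / 2 : ℝ) * (pairForm w L f g).re := by
  have htg : Continuous fun X => ((1 : ℝ) : ℂ) * g X := continuous_const.mul hg
  have hfg : Continuous fun X => f X + ((1 : ℝ) : ℂ) * g X := hf.add htg
  have hpol := toReal_potPart_add_smul hw hf hg (potForm_ne_top_of_continuous hL hw hint hf)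
    (potForm_ne_top_of_continuous hL hw hint hg) 1
  have hpot : (∫ X in cellN (m + 2) L, (periodicInteraction w L X).toReal * (conj (f X) * g X).re) =
      potRe w L f g := rfl
  rw [hpot, toReal_potForm_eq_pairs_mul hL hw hint hfg (isSymm_add_ofReal_mul hfs hgs 1),
    toReal_potForm_eq_pairs_mul hL hw hint hf hfs, toReal_potForm_eq_pairs_mul hL hw hint hg hgs,
    pairForm_add_left hL hw hint hf htg hfg, pairForm_add_right hL hw hint hf hf htg,
    pairForm_add_right hL hw hint htg hf htg, pairForm_const_mul_left, pairForm_const_mul_left,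
    pairForm_const_mul_right, pairForm_const_mul_right, Complex.conj_ofReal] at hpol
  simp only [Complex.add_re, Complex.re_ofReal_mul, pairForm_re_comm g f] at hpol
  have hC : 0 < ((m + 2) * (m + 1) / 2 : ℝ) := by positivity
  nlinarith [hpol, hC]

/-! ## Registered headline -/

/-- **Registered by-product sub-goal `stub_fsumDCPotPairs`** (line `fsum-phase-pencil`, helper of S3
`stub_phaseDoubleCommutator`): the pair reduction of the potential forms for Bose-symmetric functions,
`potRe_eq_pairs_mul` and `toReal_potForm_eq_pairs_mul`. [folklore] -/
theorem stub_fsumDCPotPairs : ∀ {m : ℕ} {L : ℝ} {w : ℝ → ℝ≥0∞}, 0 < L → Measurable w → (∫⁻ z : Space, w ‖z‖) ≠ ⊤ → ∀ {f g : Config (m + 2) → ℂ}, Continuous f → Continuous g → IsSymm f → IsSymm g → potRe w L f g = ((m + 2) * (m + 1) / 2 : ℝ) * (pairForm w L f g).re ∧ (potForm w L f).toReal = ((m + 2) * (m + 1) / 2 : ℝ) * (pairForm w L f f).re :=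
  fun hL hw hint _ _ hf hg hfs hgs =>
    ⟨potRe_eq_pairs_mul hL hw hint hf hg hfs hgs, toReal_potForm_eq_pairs_mul hL hw hint hf hfs⟩

end Summit.AtomisticToContinuum.BoseEinsteinCondensation.Cruxes.PeriodicIRBound.FsumPhasePencil

end
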